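import Mathlib.Algebra.BigOperators.Fin
import Literature.Computability.Complexity.ThresholdWeightLemmas
import HarnessLib

/-!
# Small integer weights for threshold gates (Muroga 1971; Håstad 1994, Thm. 3.2)

**Theorem** (`ThresholdWeights.exists_small_weights`). Every linear threshold function of `n`
Boolean variables, `x ↦ [t ≤ ∑ᵢ wᵢ xᵢ]` with REAL weights `wᵢ` and threshold `t`, is also
represented with INTEGER weights and threshold of absolute value at most `(n + 1)!`.

This is the classical weight bound of threshold logic (Muroga 1971, Thm. 9.3.2.1; Håstad 1994,
Thm. 3.2: "A threshold function of `n` variables can be realized with integer weights of size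
at most `2⁻ⁿ(n+1)^{(n+1)/2}`"), in the weaker form `(n+1)!` that results from bounding an
`(n+1) × (n+1)` determinant with entries in `{0, ±1}` by `(n+1)!` (Mathlib's `Matrix.det_le`)
instead of Hadamard's inequality; any bound of bit-length polynomial in `n` serves the circuit
simulations downstream (`TC⁰ ⊆ NC¹`). The proof is Håstad's (§3): among the separating affine
functions normalised to `|H(x)| ≥ 1` off the accepted side take one whose tight constraints have
maximal rank (`ThresholdWeightLemmas.exists_feasible_tightSpan_eq_top`); it is the solution of
`n + 1` independent tight equations with `0/±1` coefficients, so by Cramer's rule a common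
positive integer multiple `D` clears all denominators with numerators bounded by `(n+1)!`
(`exists_int_mul_of_tightSpan_eq_top`), and scaling by `D > 0` preserves the representation.

Also: the same statement over any finite index type (`exists_small_weights_fintype`), for
natural weights (`exists_small_weights_nat`), and the LITERAL form used by circuit simulations
(`exists_literal_threshold`): `[θ ≤ ∑ᵤ mᵤ xᵤ] = [θ' ≤ ∑ᵤ cᵤ · (xᵤ ⊕ polᵤ)]` with natural
`cᵤ ≤ (#U + 1)!` (negative weights become weights of negated inputs).

## References

* S. Muroga, *Threshold Logic and Its Applications*, Wiley 1971, Thm. 9.3.2.1 [Muroga1971].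
* J. Håstad, *On the size of weights for threshold gates*, SIAM J. Discrete Math. 7 (1994),
  §1 ("if we have a function with `n` inputs then `|wᵢ| ≤ 2⁻ⁿ(n+1)^{(n+1)/2}` is sufficient")
  and §3, Thm. 3.2 [Hastad1994].
-/

namespace Literature.Computability.Complexity

namespace ThresholdWeights

open Matrix Module Submodule Finset

/-- The dot product with a vector `snoc f (-1)`: `∑ᵢ fᵢ vᵢ - v_last`. [folklore] -/
theorem dotProduct_intCast_snoc (n : ℕ) (f : Fin n → ℤ) (v : Fin (n + 1) → ℝ) :
    (fun j => ((Fin.snoc f (-1) : Fin (n + 1) → ℤ) j : ℝ)) ⬝ᵥ v =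
      (∑ i, (f i : ℝ) * v (Fin.castSucc i)) - v (Fin.last n) := by
  simp [dotProduct, Fin.sum_univ_castSucc, Fin.snoc_castSucc, Fin.snoc_last, sub_eq_add_neg]

/-- **Small weights for threshold functions** (Muroga 1971, Thm. 9.3.2.1; Håstad 1994,
Thm. 3.2, in the weaker form `(n+1)!`): a threshold function `x ↦ [t ≤ ∑ᵢ wᵢ xᵢ]` of `n` Boolean
variables with real weights has integer weights and threshold of absolute value `≤ (n+1)!`. [cite: Hastad1994, Theorem 3.2] -/
theorem exists_small_weights (n : ℕ) (w : Fin n → ℝ) (t : ℝ) :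
    ∃ (w' : Fin n → ℤ) (t' : ℤ), (∀ i, |w' i| ≤ ((n + 1).factorial : ℤ)) ∧
      |t'| ≤ ((n + 1).factorial : ℤ) ∧
      ∀ x : Fin n → Bool, (t ≤ ∑ i, w i * (if x i then 1 else 0)) ↔
        (t' ≤ ∑ i, w' i * (if x i then 1 else 0)) := by
  classical
  -- the threshold function and the linear system `bₓ ≤ rₓ · u` in the unknowns `u = (w, t)`
  let F : (Fin n → Bool) → Prop := fun x => t ≤ ∑ i, w i * (if x i then 1 else 0)
  let ind : (Fin n → Bool) → Fin n → ℤ := fun x i => if x i then 1 else 0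
  let a₀ : (Fin n → Bool) → Fin (n + 1) → ℤ := fun x => Fin.snoc (ind x) (-1)
  let ε : (Fin n → Bool) → ℤ := fun x => if F x then 1 else -1
  let r₀ : (Fin n → Bool) → Fin (n + 1) → ℤ := fun x j => ε x * a₀ x j
  let b₀ : (Fin n → Bool) → ℤ := fun x => if F x then 0 else 1
  let r : (Fin n → Bool) → Fin (n + 1) → ℝ := fun x j => (r₀ x j : ℝ)
  let b : (Fin n → Bool) → ℝ := fun x => (b₀ x : ℝ)
  -- the affine function `sᵤ(x) = ∑ᵢ xᵢ uᵢ - u_last` and `rₓ · u = εₓ sᵤ(x)`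
  let s : (Fin (n + 1) → ℝ) → (Fin n → Bool) → ℝ := fun u x =>
    (∑ i, (ind x i : ℝ) * u (Fin.castSucc i)) - u (Fin.last n)
  have hrdot : ∀ x u, r x ⬝ᵥ u = (ε x : ℝ) * s u x := fun x u => by
    have h1 : r x = (ε x : ℝ) • fun j => ((a₀ x j : ℤ) : ℝ) := by
      funext j
      simp [r, r₀]
    rw [h1, smul_dotProduct, smul_eq_mul]
    simp only [a₀, s]
    rw [dotProduct_intCast_snoc]
  have hε : ∀ x, (ε x = 1 ∧ F x) ∨ (ε x = -1 ∧ ¬F x) := fun x => by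
    by_cases h : F x
    · exact Or.inl ⟨by simp [ε, h], h⟩
    · exact Or.inr ⟨by simp [ε, h], h⟩
  -- entries are `0/±1`
  have hind : ∀ x i, |ind x i| ≤ 1 := fun x i => by
    simp only [ind]
    split_ifs <;> simp
  have ha₀ : ∀ x j, |a₀ x j| ≤ 1 := fun x j => by
    refine Fin.lastCases ?_ (fun i => ?_) j
    · simp [a₀]
    · simp only [a₀, Fin.snoc_castSucc]
      exact hind x i
  have hr₀ : ∀ x j, |r₀ x j| ≤ 1 := fun x j => by
    simp only [r₀, abs_mul]
    rcases hε x with ⟨h, -⟩ | ⟨h, -⟩ <;> rw [h] <;> simpa using ha₀ x j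
  have hb₀ : ∀ x, |b₀ x| ≤ 1 := fun x => by
    simp only [b₀]
    split_ifs <;> simp
  -- the rows span `ℝ^(n+1)`
  have ha_mem : ∀ x, (fun j => ((a₀ x j : ℤ) : ℝ)) ∈ span ℝ (Set.range r) := fun x => by
    have h1 : (fun j => ((a₀ x j : ℤ) : ℝ)) = (ε x : ℝ) • r x := by
      funext j
      simp only [r, r₀, Pi.smul_apply, smul_eq_mul, ← mul_assoc, ← Int.cast_mul]
      rcases hε x with ⟨h, -⟩ | ⟨h, -⟩ <;> simp [h]
    rw [h1]
    exact Submodule.smul_mem _ _ (Submodule.subset_span ⟨x, rfl⟩)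
  have hlast : Pi.single (Fin.last n) (1 : ℝ) ∈ span ℝ (Set.range r) := by
    have h1 : Pi.single (Fin.last n) (1 : ℝ) = -fun j => ((a₀ (fun _ => false) j : ℤ) : ℝ) := by
      funext j
      refine Fin.lastCases ?_ (fun i => ?_) j
      · simp [a₀]
      · rw [Pi.single_eq_of_ne (Fin.castSucc_lt_last i).ne]
        simp [a₀, ind]
    rw [h1]
    exact Submodule.neg_mem _ (ha_mem _)
  have hsingle : ∀ i : Fin n, Pi.single (Fin.castSucc i) (1 : ℝ) ∈ span ℝ (Set.range r) := by
    intro i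
    have h1 : Pi.single (Fin.castSucc i) (1 : ℝ) =
        (fun j => ((a₀ (fun i' => decide (i' = i)) j : ℤ) : ℝ)) + Pi.single (Fin.last n) (1 : ℝ) := by
      funext j
      refine Fin.lastCases ?_ (fun i' => ?_) j
      · rw [Pi.single_eq_of_ne (Fin.castSucc_lt_last i).ne']
        simp [a₀]
      · rw [Pi.add_apply, Pi.single_eq_of_ne (Fin.castSucc_lt_last i').ne, Pi.single_apply]
        simp only [a₀, ind, Fin.snoc_castSucc, Fin.castSucc_inj, decide_eq_true_eq, add_zero]
        split_ifs <;> simp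
    rw [h1]
    exact Submodule.add_mem _ (ha_mem _) hlast
  have hspan : span ℝ (Set.range r) = ⊤ := by
    rw [eq_top_iff, ← (Pi.basisFun ℝ (Fin (n + 1))).span_eq, Submodule.span_le]
    rintro _ ⟨j, rfl⟩
    rw [Pi.basisFun_apply]
    exact Fin.lastCases hlast (fun i => hsingle i) j
  -- a feasible point: `(w, t)` scaled by the smallest gap of a rejected point
  have hsF : ∀ x, s (Fin.snoc w t) x = (∑ i, w i * (if x i then 1 else 0)) - t := fun x => by
    simp only [s, Fin.snoc_castSucc, Fin.snoc_last, ind, Int.cast_ite, Int.cast_one, Int.cast_zero]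
    congr 1
    exact Finset.sum_congr rfl fun i _ => by split_ifs <;> simp
  have hfeas : ∃ u, Feasible r b u := by
    let Rej := univ.filter fun x => ¬F x
    by_cases hRej : Rej.Nonempty
    · let gap : (Fin n → Bool) → ℝ := fun x => t - ∑ i, w i * (if x i then 1 else 0)
      set δ := (Rej.image gap).min' (hRej.image _) with hδ
      have hδmem := Finset.min'_mem (Rej.image gap) (hRej.image _)
      obtain ⟨x₀, hx₀, hx₀δ⟩ := Finset.mem_image.1 hδmem
      have hδpos : 0 < δ := by
        rw [hδ.trans hx₀δ.symm]
        have : ¬F x₀ := (Finset.mem_filter.1 hx₀).2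
        simp only [F, not_le] at this
        simp only [gap]
        linarith
      have hδle : ∀ x, ¬F x → δ ≤ gap x := fun x hx =>
        Finset.min'_le _ _ (Finset.mem_image.2 ⟨x, Finset.mem_filter.2 ⟨Finset.mem_univ _, hx⟩, rfl⟩)
      refine ⟨δ⁻¹ • Fin.snoc w t, fun x => ?_⟩
      rw [dotProduct_smul, hrdot, hsF, smul_eq_mul]
      rcases hε x with ⟨h, hF⟩ | ⟨h, hF⟩
      · have hF' : t ≤ ∑ i, w i * (if x i then 1 else 0) := hF
        simp only [b, b₀, hF, ↓reduceIte, Int.cast_zero, h, Int.cast_one, one_mul]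
        exact mul_nonneg (inv_nonneg.2 hδpos.le) (sub_nonneg.2 hF')
      · have hgap := hδle x hF
        simp only [gap] at hgap
        simp only [b, b₀, hF, ↓reduceIte, Int.cast_one, h, Int.cast_neg, neg_mul, one_mul]
        rw [le_inv_mul_iff₀ hδpos]
        linarith
    · refine ⟨Fin.snoc w t, fun x => ?_⟩
      have hFx : F x := by
        by_contra h
        exact hRej ⟨x, Finset.mem_filter.2 ⟨Finset.mem_univ _, h⟩⟩
      have hF' : t ≤ ∑ i, w i * (if x i then 1 else 0) := hFx
      rw [hrdot, hsF]
      rcases hε x with ⟨h, -⟩ | ⟨-, h⟩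
      · simp only [b, b₀, hFx, ↓reduceIte, Int.cast_zero, h, Int.cast_one, one_mul, sub_nonneg]
        exact hF'
      · exact absurd hFx h
  -- the vertex and its integer multiple
  obtain ⟨ustar, hustar, htop⟩ := exists_feasible_tightSpan_eq_top r b hspan hfeas
  obtain ⟨z, D, hD, hzb, hz⟩ := exists_int_mul_of_tightSpan_eq_top r₀ b₀ hr₀ hb₀ ustar htop
  refine ⟨fun i => z (Fin.castSucc i), z (Fin.last n), fun i => hzb _, hzb _, fun x => ?_⟩
  -- `F x ↔ 0 ≤ s(x)` at the vertex
  have hFs : F x ↔ 0 ≤ s ustar x := by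
    have hfx := hustar x
    rw [hrdot] at hfx
    rcases hε x with ⟨h, hF⟩ | ⟨h, hF⟩
    · simp only [b, b₀, hF, ↓reduceIte, Int.cast_zero, h, Int.cast_one, one_mul] at hfx
      exact ⟨fun _ => hfx, fun _ => hF⟩
    · simp only [b, b₀, hF, ↓reduceIte, Int.cast_one, h, Int.cast_neg, neg_mul, one_mul] at hfx
      exact ⟨fun h' => absurd h' hF, fun h' => by linarith⟩
  -- the integer form is `D · s(x)`
  have hzs : (((∑ i, z (Fin.castSucc i) * (if x i then 1 else 0)) - z (Fin.last n) : ℤ) : ℝ) =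
      D * s ustar x := by
    push_cast
    simp only [s, hz, ind, Int.cast_ite, Int.cast_one, Int.cast_zero]
    rw [mul_sub, Finset.mul_sum]
    congr 1
    exact Finset.sum_congr rfl fun i _ => by ring
  have hDpos : (0 : ℝ) < D := by exact_mod_cast hD
  show F x ↔ _
  rw [hFs]
  constructor
  · intro hs0
    have h1 : (0 : ℝ) ≤ (((∑ i, z (Fin.castSucc i) * (if x i then 1 else 0)) - z (Fin.last n) : ℤ) : ℝ) := by
      rw [hzs]
      exact mul_nonneg hDpos.le hs0
    have h2 : (0 : ℤ) ≤ (∑ i, z (Fin.castSucc i) * (if x i then 1 else 0)) - z (Fin.last n) := by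
      exact_mod_cast h1
    linarith
  · intro hle
    have h0 : (0 : ℤ) ≤ (∑ i, z (Fin.castSucc i) * (if x i then 1 else 0)) - z (Fin.last n) := by
      linarith
    have h1 : (0 : ℝ) ≤ D * s ustar x := by
      rw [← hzs]
      exact_mod_cast h0
    exact (mul_nonneg_iff_of_pos_left hDpos).1 h1

/-- The weight bound over an arbitrary finite index type. [cite: Hastad1994, Theorem 3.2] -/
theorem exists_small_weights_fintype {U : Type*} [Fintype U] (m : U → ℝ) (t : ℝ) :
    ∃ (w' : U → ℤ) (t' : ℤ), (∀ u, |w' u| ≤ ((Fintype.card U + 1).factorial : ℤ)) ∧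
      |t'| ≤ ((Fintype.card U + 1).factorial : ℤ) ∧
      ∀ x : U → Bool, (t ≤ ∑ u, m u * (if x u then 1 else 0)) ↔
        (t' ≤ ∑ u, w' u * (if x u then 1 else 0)) := by
  classical
  set e := Fintype.equivFin U with he
  obtain ⟨w', t', hw', ht', h⟩ := exists_small_weights (Fintype.card U) (fun i => m (e.symm i)) t
  refine ⟨fun u => w' (e u), t', fun u => hw' _, ht', fun x => ?_⟩
  have hL : ∑ u, m u * (if x u then (1 : ℝ) else 0) =
      ∑ i, m (e.symm i) * (if x (e.symm i) then 1 else 0) :=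
    (e.symm.sum_comp (fun u => m u * (if x u then (1 : ℝ) else 0))).symm
  have hR : ∑ u, w' (e u) * (if x u then (1 : ℤ) else 0) =
      ∑ i, w' i * (if x (e.symm i) then 1 else 0) := by
    rw [← e.symm.sum_comp (fun u => w' (e u) * (if x u then (1 : ℤ) else 0))]
    simp
  rw [hL, hR]
  exact h _

/-- The weight bound for natural weights and threshold (the case of gates whose inputs are
wires read with multiplicities). [cite: Hastad1994, Theorem 3.2] -/
theorem exists_small_weights_nat {U : Type*} [Fintype U] (m : U → ℕ) (θ : ℕ) :
    ∃ (w' : U → ℤ) (t' : ℤ), (∀ u, |w' u| ≤ ((Fintype.card U + 1).factorial : ℤ)) ∧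
      |t'| ≤ ((Fintype.card U + 1).factorial : ℤ) ∧
      ∀ x : U → Bool, (θ ≤ ∑ u, m u * (x u).toNat) ↔ (t' ≤ ∑ u, w' u * (if x u then 1 else 0)) := by
  obtain ⟨w', t', hw', ht', h⟩ := exists_small_weights_fintype (fun u => (m u : ℝ)) (θ : ℝ)
  refine ⟨w', t', hw', ht', fun x => ?_⟩
  rw [← h x]
  have h1 : ((∑ u, m u * (x u).toNat : ℕ) : ℝ) = ∑ u, (m u : ℝ) * (if x u then 1 else 0) := by
    push_cast
    exact Finset.sum_congr rfl fun u _ => by cases x u <;> simp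
  rw [← h1, Nat.cast_le]

/-- **Literal form**: a threshold gate with natural weights equals a threshold of NATURAL
weights `cᵤ ≤ (#U + 1)!` over the LITERALS `xᵤ ⊕ polᵤ` (a negative weight `w` on `xᵤ` is the
weight `|w|` on `¬xᵤ` minus the constant `|w|`). This is the form fed to the log-depth
threshold circuits of `NCThreshold.lean`. [cite: Hastad1994, Theorem 3.2] -/
theorem exists_literal_threshold {U : Type*} [Fintype U] (m : U → ℕ) (θ : ℕ) :
    ∃ (c : U → ℕ) (pol : U → Bool) (θ' : ℕ), (∀ u, c u ≤ (Fintype.card U + 1).factorial) ∧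
      ∀ x : U → Bool, decide (θ ≤ ∑ u, m u * (x u).toNat) =
        decide (θ' ≤ ∑ u, c u * ((x u).xor (pol u)).toNat) := by
  obtain ⟨w', t', hw', -, h⟩ := exists_small_weights_nat m θ
  let N : ℤ := ∑ u, if w' u < 0 then -w' u else 0
  refine ⟨fun u => (w' u).natAbs, fun u => decide (w' u < 0), (t' + N).toNat, fun u => ?_,
    fun x => ?_⟩
  · have h1 : ((w' u).natAbs : ℤ) ≤ ((Fintype.card U + 1).factorial : ℤ) := by
      rw [Int.natCast_natAbs]
      exact hw' u
    exact_mod_cast h1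
  · rw [decide_eq_decide, h x]
    have key : ∑ u, w' u * (if x u then 1 else 0) =
        ((∑ u, (w' u).natAbs * ((x u).xor (decide (w' u < 0))).toNat : ℕ) : ℤ) - N := by
      simp only [N]
      rw [Nat.cast_sum, ← Finset.sum_sub_distrib]
      refine Finset.sum_congr rfl fun u _ => ?_
      by_cases hw : w' u < 0
      · have habs : ((w' u).natAbs : ℤ) = -w' u := Int.ofNat_natAbs_of_nonpos hw.le
        cases x u <;> simp [hw, habs]
      · have hw0 : 0 ≤ w' u := not_lt.1 hw
        have habs : ((w' u).natAbs : ℤ) = w' u := Int.natAbs_of_nonneg hw0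
        cases x u <;> simp [hw, habs]
    rw [key, le_sub_iff_add_le]
    exact Int.toNat_le.symm

end ThresholdWeights

end Literature.Computability.Complexity
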